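import Mathlib
import Summits.KontsevichZagierPeriods.Zeta5Search.Elimination.PencilGauge
import Summits.KontsevichZagierPeriods.Zeta5Search.Elimination.HalfShift
import Summits.KontsevichZagierPeriods.Zeta5Search.WedgeDictionaryFaceBookkeeping
import HarnessLib

/-!
# The gauge `ρ` under the half-shift (E-L19c, part 2b₁; fam-elim gen 23)

HONEST FRAMING: systematic search; no irrationality claim unless certified — pure factorial bookkeeping for the
scalar `ρ = rhoB` of the wedge dictionary; nothing here is about sizes or irrationality.

`H = hShift` raises the level and the slots `T = {4,5,7}` by one.  Of the fifteen edge pairs `E` of `ρ`, the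
five inside `{1,2,3,6}` gain one in `b₀ − b_j − b_k`, the two inside `T` (`47`, `57`) lose one, the eight mixed
ones are unchanged; the slot factorials of `4,5,7` gain one factor each; `Σ_j b_j` gains `3` (sign flips);
`d` is unchanged (`dOf_hShift`).  Hence (`rhoB_hShift`)

  `ρ(Hz) · (z₀−z₄−z₇)(z₀−z₅−z₇) · (z₄+1)(z₅+1)(z₇+1) = −∏_{(j,k) ∈ {12,13,23,26,36}} (z₀+1−z_j−z_k) · ρ(z)`

for `z` in the box with `z₄+z₇+1 ≤ z₀`, `z₅+z₇+1 ≤ z₀` and the five inner pair sums `≤ z₀`; and, for convenience, the `z`-form of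
`rhoB_lower` along slot `7` (`rhoB_bump6`): `ρ(z)·d(z) = −(z₇+1)·∏_{k∈{3,4,5,6}}(z₀−z_k−z₇)·ρ(z+e₇)`.  Together with
`rhoB_dsShift` (`Elimination/PencilGauge`) these are the three gauge ratios needed to turn the ρ-free half-shift
BRIDGE (`Elimination/HalfShiftBridge`) into gen-1's `DictBridge` (closed-form check of all three ratios:
`HOME/pub-zeta5-fam-elim/g23/e19/probe45.py`).
-/

open Finset

namespace Summit.KontsevichZagierPeriods.Zeta5Search.Elimination

open Summit.KontsevichZagierPeriods.Zeta5Search.DualSeries (InBox)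
open Summit.KontsevichZagierPeriods.Zeta5Search.WedgeDictionary
open Summit.KontsevichZagierPeriods.Zeta5Search.SymmetricGauge

/-- The values of `hShift`. -/
theorem hShift_vals (z : ℕ → ℤ) :
    hShift z 0 = z 0 + 1 ∧ hShift z 1 = z 1 ∧ hShift z 2 = z 2 ∧ hShift z 3 = z 3 ∧ hShift z 4 = z 4 + 1 ∧
      hShift z 5 = z 5 + 1 ∧ hShift z 6 = z 6 ∧ hShift z 7 = z 7 + 1 := by
  unfold hShift
  simp

/-- The sign of `ρ` flips under `H` (`Σ_j b_j` gains `3`). -/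
theorem rhoSign_hShift (z : ℕ → ℤ) (hz : InBox z) :
    (-1 : ℚ) ^ (∑ j ∈ range 7, hShift z (j + 1)).toNat = -(-1 : ℚ) ^ (∑ j ∈ range 7, z (j + 1)).toNat := by
  have hsum : 0 ≤ ∑ j ∈ range 7, z (j + 1) := sum_nonneg fun j hj => (hz.2 j hj).1
  rw [sum_hShift, show (∑ j ∈ range 7, z (j + 1) + 3).toNat = (∑ j ∈ range 7, z (j + 1)).toNat + 3 by omega,
    pow_add]
  norm_num

/-- The slot factorials of `ρ` under `H`: slots `4, 5, 7` gain one factor each. -/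
theorem rhoSlots_hShift (z : ℕ → ℤ) (hz : InBox z) :
    ((([1, 4, 5, 6, 7] : List ℕ).map fun j => ((hShift z j).toNat.factorial : ℚ)).prod) =
      ((z 4 : ℚ) + 1) * ((z 5 : ℚ) + 1) * ((z 7 : ℚ) + 1) *
        ((([1, 4, 5, 6, 7] : List ℕ).map fun j => ((z j).toNat.factorial : ℚ)).prod) := by
  obtain ⟨-, v1, -, -, v4, v5, v6, v7⟩ := hShift_vals z
  have h4 : 0 ≤ z 4 := (hz.2 3 (by simp)).1
  have h5 : 0 ≤ z 5 := (hz.2 4 (by simp)).1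
  have h7 : 0 ≤ z 7 := (hz.2 6 (by simp)).1
  simp only [List.map, List.prod_cons, List.prod_nil, v1, v4, v5, v6, v7]
  rw [toNat_factorial_succ (z 4) h4, toNat_factorial_succ (z 5) h5, toNat_factorial_succ (z 7) h7]
  ring

/-- The edge-pair factorials of `ρ` under `H`: the five pairs inside `{1,2,3,6}` gain a factor
`(z₀+1−z_j−z_k)`, the pairs `47`, `57` lose `(z₀−z₄−z₇)`, `(z₀−z₅−z₇)`. -/
theorem rhoPairs_hShift (z : ℕ → ℤ) (h47 : z 4 + z 7 + 1 ≤ z 0) (h57 : z 5 + z 7 + 1 ≤ z 0)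
    (h12 : z 1 + z 2 ≤ z 0) (h13 : z 1 + z 3 ≤ z 0) (h23 : z 2 + z 3 ≤ z 0) (h26 : z 2 + z 6 ≤ z 0)
    (h36 : z 3 + z 6 ≤ z 0) :
    (Epairs.map fun jk => ((hShift z 0 - hShift z jk.1 - hShift z jk.2).toNat.factorial : ℚ)).prod *
        (((z 0 : ℚ) - z 4 - z 7) * ((z 0 : ℚ) - z 5 - z 7)) =
      ((z 0 : ℚ) + 1 - z 1 - z 2) * ((z 0 : ℚ) + 1 - z 1 - z 3) * ((z 0 : ℚ) + 1 - z 2 - z 3) *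
          ((z 0 : ℚ) + 1 - z 2 - z 6) * ((z 0 : ℚ) + 1 - z 3 - z 6) *
        (Epairs.map fun jk => ((z 0 - z jk.1 - z jk.2).toNat.factorial : ℚ)).prod := by
  obtain ⟨v0, v1, v2, v3, v4, v5, v6, v7⟩ := hShift_vals z
  -- the fifteen differences at `Hz`, normalised
  have p12 : hShift z 0 - hShift z 1 - hShift z 2 = (z 0 - z 1 - z 2) + 1 := by rw [v0, v1, v2]; ring
  have p13 : hShift z 0 - hShift z 1 - hShift z 3 = (z 0 - z 1 - z 3) + 1 := by rw [v0, v1, v3]; ring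
  have p14 : hShift z 0 - hShift z 1 - hShift z 4 = z 0 - z 1 - z 4 := by rw [v0, v1, v4]; ring
  have p15 : hShift z 0 - hShift z 1 - hShift z 5 = z 0 - z 1 - z 5 := by rw [v0, v1, v5]; ring
  have p23 : hShift z 0 - hShift z 2 - hShift z 3 = (z 0 - z 2 - z 3) + 1 := by rw [v0, v2, v3]; ring
  have p24 : hShift z 0 - hShift z 2 - hShift z 4 = z 0 - z 2 - z 4 := by rw [v0, v2, v4]; ring
  have p25 : hShift z 0 - hShift z 2 - hShift z 5 = z 0 - z 2 - z 5 := by rw [v0, v2, v5]; ring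
  have p26 : hShift z 0 - hShift z 2 - hShift z 6 = (z 0 - z 2 - z 6) + 1 := by rw [v0, v2, v6]; ring
  have p34 : hShift z 0 - hShift z 3 - hShift z 4 = z 0 - z 3 - z 4 := by rw [v0, v3, v4]; ring
  have p36 : hShift z 0 - hShift z 3 - hShift z 6 = (z 0 - z 3 - z 6) + 1 := by rw [v0, v3, v6]; ring
  have p37 : hShift z 0 - hShift z 3 - hShift z 7 = z 0 - z 3 - z 7 := by rw [v0, v3, v7]; ring
  have p47 : hShift z 0 - hShift z 4 - hShift z 7 = z 0 - z 4 - z 7 - 1 := by rw [v0, v4, v7]; ring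
  have p56 : hShift z 0 - hShift z 5 - hShift z 6 = z 0 - z 5 - z 6 := by rw [v0, v5, v6]; ring
  have p57 : hShift z 0 - hShift z 5 - hShift z 7 = z 0 - z 5 - z 7 - 1 := by rw [v0, v5, v7]; ring
  have p67 : hShift z 0 - hShift z 6 - hShift z 7 = z 0 - z 6 - z 7 := by rw [v0, v6, v7]; ring
  simp only [Epairs, List.map, List.prod_cons, List.prod_nil, p12, p13, p14, p15, p23, p24, p25, p26, p34, p36,
    p37, p47, p56, p57, p67]
  -- the two `T`-pairs on the right: `(z₀−z₄−z₇)! = (z₀−z₄−z₇)·(z₀−z₄−z₇−1)!`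
  rw [show z 0 - z 4 - z 7 = (z 0 - z 4 - z 7 - 1) + 1 by ring,
    show z 0 - z 5 - z 7 = (z 0 - z 5 - z 7 - 1) + 1 by ring]
  simp only [add_sub_cancel_right]
  rw [toNat_factorial_succ (z 0 - z 4 - z 7 - 1) (by omega),
    toNat_factorial_succ (z 0 - z 5 - z 7 - 1) (by omega),
    toNat_factorial_succ (z 0 - z 1 - z 2) (by omega), toNat_factorial_succ (z 0 - z 1 - z 3) (by omega),
    toNat_factorial_succ (z 0 - z 2 - z 3) (by omega), toNat_factorial_succ (z 0 - z 2 - z 6) (by omega),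
    toNat_factorial_succ (z 0 - z 3 - z 6) (by omega)]
  push_cast
  ring

/-- **The gauge under the half-shift**:
`ρ(Hz)·(z₀−z₄−z₇)(z₀−z₅−z₇)·(z₄+1)(z₅+1)(z₇+1) = −(z₀+1−z₁−z₂)(z₀+1−z₁−z₃)(z₀+1−z₂−z₃)(z₀+1−z₂−z₆)(z₀+1−z₃−z₆)·ρ(z)`. -/
theorem rhoB_hShift (z : ℕ → ℤ) (hz : InBox z) (h47 : z 4 + z 7 + 1 ≤ z 0) (h57 : z 5 + z 7 + 1 ≤ z 0)
    (h12 : z 1 + z 2 ≤ z 0) (h13 : z 1 + z 3 ≤ z 0) (h23 : z 2 + z 3 ≤ z 0) (h26 : z 2 + z 6 ≤ z 0)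
    (h36 : z 3 + z 6 ≤ z 0) :
    rhoB (hShift z) * (((z 0 : ℚ) - z 4 - z 7) * ((z 0 : ℚ) - z 5 - z 7)) *
        (((z 4 : ℚ) + 1) * ((z 5 : ℚ) + 1) * ((z 7 : ℚ) + 1)) =
      -(((z 0 : ℚ) + 1 - z 1 - z 2) * ((z 0 : ℚ) + 1 - z 1 - z 3) * ((z 0 : ℚ) + 1 - z 2 - z 3) *
          ((z 0 : ℚ) + 1 - z 2 - z 6) * ((z 0 : ℚ) + 1 - z 3 - z 6) * rhoB z) := by
  have hP := rhoPairs_hShift z h47 h57 h12 h13 h23 h26 h36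
  have h4 : (0 : ℚ) ≤ z 4 := by exact_mod_cast (hz.2 3 (by simp)).1
  have h5 : (0 : ℚ) ≤ z 5 := by exact_mod_cast (hz.2 4 (by simp)).1
  have h7 : (0 : ℚ) ≤ z 7 := by exact_mod_cast (hz.2 6 (by simp)).1
  have hT : ((z 4 : ℚ) + 1) * ((z 5 : ℚ) + 1) * ((z 7 : ℚ) + 1) ≠ 0 :=
    mul_ne_zero (mul_ne_zero (ne_of_gt (by linarith)) (ne_of_gt (by linarith))) (ne_of_gt (by linarith))
  unfold rhoB
  rw [dOf_hShift, rhoSign_hShift z hz, rhoSlots_hShift z hz]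
  -- make the three linear factors opaque atoms, so that `ring` only ever inverts monomials
  generalize ((z 4 : ℚ) + 1) = a4 at hT ⊢
  generalize ((z 5 : ℚ) + 1) = a5 at hT ⊢
  generalize ((z 7 : ℚ) + 1) = a7 at hT ⊢
  have hTinv : a4 * a5 * a7 * (a4 * a5 * a7)⁻¹ = 1 := mul_inv_cancel₀ hT
  linear_combination
    (-(-1 : ℚ) ^ (∑ j ∈ range 7, z (j + 1)).toNat /
        (4 * ((([1, 4, 5, 6, 7] : List ℕ).map fun j => ((z j).toNat.factorial : ℚ)).prod) *
          ((dOf z).toNat.factorial : ℚ)) *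
      ((Epairs.map fun jk => ((hShift z 0 - hShift z jk.1 - hShift z jk.2).toNat.factorial : ℚ)).prod *
        (((z 0 : ℚ) - z 4 - z 7) * ((z 0 : ℚ) - z 5 - z 7)))) * hTinv +
    (-(-1 : ℚ) ^ (∑ j ∈ range 7, z (j + 1)).toNat /
        (4 * ((([1, 4, 5, 6, 7] : List ℕ).map fun j => ((z j).toNat.factorial : ℚ)).prod) *
          ((dOf z).toNat.factorial : ℚ))) * hP

/-- **The gauge under the slot-`7` step** (the `z`-form of `rhoB_lower` at `P = z + e₇`, `s = 6`):
`ρ(z)·d(z) = −(z₇+1)·(z₀−z₃−z₇)(z₀−z₄−z₇)(z₀−z₅−z₇)(z₀−z₆−z₇)·ρ(z+e₇)`. -/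
theorem rhoB_bump6 (z : ℕ → ℤ) (hz : InBox z) (h7 : z 7 + 1 ≤ z 0) (hd : 1 ≤ dOf z)
    (hE : ∀ jk ∈ Epairs, bump z 6 jk.1 + bump z 6 jk.2 ≤ z 0) :
    rhoB z * (dOf z : ℚ) =
      -(((z 7 : ℚ) + 1) * (((z 0 : ℚ) - z 3 - z 7) * ((z 0 : ℚ) - z 4 - z 7) * ((z 0 : ℚ) - z 5 - z 7) *
        ((z 0 : ℚ) - z 6 - z 7)) * rhoB (bump z 6)) := by
  have h70 : 0 ≤ z 7 := (hz.2 6 (by simp)).1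
  have hP : InBox (bump z 6) := inBox_bump6 z hz (by omega)
  have hi : 1 ≤ bump z 6 (6 + 1) := by
    show 1 ≤ bump z 6 7
    rw [bump6_seven]; omega
  have hdP : 0 ≤ dOf (bump z 6) := by rw [dOf_bump z (by simp)]; omega
  have hE' : ∀ jk ∈ Epairs, bump z 6 jk.1 + bump z 6 jk.2 ≤ bump z 6 0 := fun jk hjk => by
    rw [bump_zero]; exact hE jk hjk
  have key := rhoB_lower (bump z 6) (s := 6) (by norm_num) hP hi hdP hE'
  simp only [show (6 : ℕ) + 1 = 7 from rfl] at key
  have v0 : bump z 6 0 = z 0 := bump_zero z 6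
  have v3 : bump z 6 3 = z 3 := bump_of_ne z (by norm_num)
  have v4 : bump z 6 4 = z 4 := bump_of_ne z (by norm_num)
  have v5 : bump z 6 5 = z 5 := bump_of_ne z (by norm_num)
  have v6 : bump z 6 6 = z 6 := bump_of_ne z (by norm_num)
  have v7 : bump z 6 7 = z 7 + 1 := bump6_seven z
  have hupd : Function.update (bump z 6) 7 (bump z 6 7 - 1) = z := by
    funext k
    by_cases hk : k = 7
    · rw [hk, Function.update_self, v7]; ring
    · rw [Function.update_of_ne hk, bump_of_ne z hk]
  have hchi : (chiOf (bump z 6) 7 : ℚ) = 1 := by simp [chiOf]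
  have hedge : edgeProd (bump z 6) 7 = ((z 0 : ℚ) - z 3 - z 7) * ((z 0 : ℚ) - z 4 - z 7) *
      ((z 0 : ℚ) - z 5 - z 7) * ((z 0 : ℚ) - z 6 - z 7) := by
    simp only [edgeProd, Epairs, List.map_cons, List.map_nil, List.prod_cons, List.prod_nil, v0, v3, v4, v5, v6,
      v7]
    norm_num
    ring
  rw [hupd, hchi, hedge, dOf_bump z (by simp), v7] at key
  push_cast at key
  linear_combination key

end Summit.KontsevichZagierPeriods.Zeta5Search.Elimination
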